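import Literature.MathematicalPhysics.QuantumLattice.HubbardTTPrimeThermalPressureSpinSectorsConcave
import Mathlib.Analysis.LocallyConvex.Separation
import HarnessLib

/-!
# Supporting planes of the spin-resolved thermal pressure: every interior spin-density pair `(n↑, n↓)` has a
# supergradient

Topic `MathematicalPhysics/QuantumLattice` (family `hubbard`); sequel of `HubbardTTPrimeThermalPressureSpinSectorsConcave.lean`
(`p(β; t,t',U; x, y) = pressureTT'₂ β t t' U x y` is jointly concave and continuous on `[0,1)²`). For the two-variable
Legendre duality `(n↑, n↓) ↔ (μ, h)` one needs, at every INTERIOR point `(x₀, y₀) ∈ (0,1)²`, a supporting plane: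

* `exists_supporting_plane_pressureTT'₂` — `∃ s₁ s₂, ∀ (u, v) ∈ [0,1)², p(u, v) ≤ p(x₀, y₀) + s₁(u − x₀) + s₂(v − y₀)`.

Proof: the strict hypograph `{(u, v, r) : (u,v) ∈ (0,1)², r < p(u,v)}` is open (continuity) and convex (concavity) and
misses the point `(x₀, y₀, p(x₀,y₀))`; the geometric Hahn–Banach theorem (`geometric_hahn_banach_open_point`) gives a
continuous linear functional separating them, whose `r`-coefficient is positive; normalising it gives the plane on the
open square, and continuity extends the inequality to the half-open square. (The one-variable analogue for `pressureTT'`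
is `exists_supporting_line_pressureTT'`, `HubbardTTPrimeThermalPressureDensityAnchors`.)

Everything is PROVED; no definition, no named fact.

## Mathlib / tree search

REUSED: `concaveOn_pressureTT'₂`, `continuousOn_pressureTT'₂` (`HubbardTTPrimeThermalPressureSpinSectorsConcave`), Mathlib
`geometric_hahn_banach_open_point`, `ContinuousOn.isOpen_inter_preimage`, `ContinuousLinearMap.map_add/map_smul`.
`lean search 'supporting.*pressureTT.₂|supergradient'`: nothing (2026-08-27).

## References

* R. T. Rockafellar, *Convex Analysis* (1970), Thm. 23.4 (subgradients exist at interior points), here via Hahn–Banach;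
  D. Ruelle, *Statistical Mechanics: Rigorous Results* (1969), §3.4. [cite: Ruelle1969, §3.4]
* R. B. Israel, *Convexity in the Theory of Lattice Gases* (1979), Thm. I.2.4. [cite: Israel1979, Thm. I.2.4]
-/

noncomputable section

namespace Literature.MathematicalPhysics.QuantumLattice

open Matrix Finset HubbardWave0 Literature.Probability.LatticeModels LiebThm1
open _root_.Filter
open scoped _root_.Topology ComplexOrder BigOperators

namespace ThermodynamicLimit

section SupportingPlane

variable {β : ℝ} (hβ : 0 ≤ β) (t t' : ℝ) {U : ℝ} (hU : 0 ≤ U)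
include hβ hU

/-- The inequality on the open square extends to the half-open square by continuity. [cite: Ruelle1969, §3.4] -/
private theorem plane_extend {x₀ y₀ s₁ s₂ : ℝ}
    (h : ∀ u v : ℝ, 0 < u → u < 1 → 0 < v → v < 1 →
      pressureTT'₂ β t t' U u v ≤ pressureTT'₂ β t t' U x₀ y₀ + s₁ * (u - x₀) + s₂ * (v - y₀))
    {u v : ℝ} (hu0 : 0 ≤ u) (hu1 : u < 1) (hv0 : 0 ≤ v) (hv1 : v < 1) :
    pressureTT'₂ β t t' U u v ≤ pressureTT'₂ β t t' U x₀ y₀ + s₁ * (u - x₀) + s₂ * (v - y₀) := by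
  -- approach `(u, v)` from inside the open square along `(u + δ_n, v + δ_n)`
  obtain ⟨δ, hδ⟩ : ∃ δ : ℕ → ℝ, ∀ n, δ n = min (1 - u) (1 - v) / ((n : ℝ) + 2) := ⟨_, fun n => rfl⟩
  have hm : 0 < min (1 - u) (1 - v) := lt_min (by linarith) (by linarith)
  have hδpos : ∀ n, 0 < δ n := fun n => by rw [hδ]; positivity
  have hδlt : ∀ n, δ n < min (1 - u) (1 - v) := fun n => by
    rw [hδ]
    have h2 : (1 : ℝ) < (n : ℝ) + 2 := by have := Nat.cast_nonneg (α := ℝ) n; linarith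
    exact div_lt_self hm h2
  have hmem : ∀ n, (u + δ n, v + δ n) ∈ Set.Ico (0 : ℝ) 1 ×ˢ Set.Ico (0 : ℝ) 1 := fun n =>
    ⟨⟨by linarith [hδpos n], by linarith [hδlt n, min_le_left (1 - u) (1 - v)]⟩,
      ⟨by linarith [hδpos n], by linarith [hδlt n, min_le_right (1 - u) (1 - v)]⟩⟩
  have hδlim : Tendsto δ atTop (𝓝 0) := by
    have h1 : Tendsto (fun n : ℕ => (n : ℝ) + 2) atTop atTop :=
      tendsto_atTop_add_const_right _ 2 tendsto_natCast_atTop_atTop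
    have h2 := h1.inv_tendsto_atTop
    have h3 := h2.const_mul (min (1 - u) (1 - v))
    rw [mul_zero] at h3
    refine h3.congr fun n => ?_
    rw [hδ, div_eq_mul_inv]
    rfl
  have hzlim : Tendsto (fun n => (u + δ n, v + δ n)) atTop (𝓝[Set.Ico (0 : ℝ) 1 ×ˢ Set.Ico (0 : ℝ) 1] (u, v)) := by
    refine tendsto_nhdsWithin_iff.2 ⟨?_, Eventually.of_forall hmem⟩
    have hu' : Tendsto (fun n => u + δ n) atTop (𝓝 u) := by
      have := hδlim.const_add u; rwa [add_zero] at this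
    have hv' : Tendsto (fun n => v + δ n) atTop (𝓝 v) := by
      have := hδlim.const_add v; rwa [add_zero] at this
    exact hu'.prodMk_nhds hv'
  have hcont := (continuousOn_pressureTT'₂ hβ t t' hU) (u, v) ⟨⟨hu0, hu1⟩, ⟨hv0, hv1⟩⟩
  have hF := hcont.tendsto.comp hzlim
  have hG : Tendsto (fun n => pressureTT'₂ β t t' U x₀ y₀ + s₁ * (u + δ n - x₀) + s₂ * (v + δ n - y₀)) atTop
      (𝓝 (pressureTT'₂ β t t' U x₀ y₀ + s₁ * (u + 0 - x₀) + s₂ * (v + 0 - y₀))) :=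
    (tendsto_const_nhds.add (((hδlim.const_add u).sub_const x₀).const_mul s₁)).add
      (((hδlim.const_add v).sub_const y₀).const_mul s₂)
  rw [add_zero, add_zero] at hG
  refine le_of_tendsto_of_tendsto hF hG (Eventually.of_forall fun n => ?_)
  simp only [Function.comp_apply]
  exact h _ _ (by linarith [hδpos n]) (hmem n).1.2 (by linarith [hδpos n]) (hmem n).2.2

/-- **Supporting plane of the spin-resolved pressure at an interior point.** For `β ≥ 0`, `U ≥ 0` and
`(x₀, y₀) ∈ (0,1)²` there are slopes `s₁, s₂` with
`p(β; t,t',U; u, v) ≤ p(β; t,t',U; x₀, y₀) + s₁ (u − x₀) + s₂ (v − y₀)` for all `(u, v) ∈ [0,1)²`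
(geometric Hahn–Banach for the open convex strict hypograph). [cite: Ruelle1969, §3.4] [cite: Israel1979, Thm. I.2.4] -/
theorem exists_supporting_plane_pressureTT'₂ {x₀ y₀ : ℝ} (hx0 : 0 < x₀) (hx1 : x₀ < 1) (hy0 : 0 < y₀) (hy1 : y₀ < 1) :
    ∃ s₁ s₂ : ℝ, ∀ u v : ℝ, 0 ≤ u → u < 1 → 0 ≤ v → v < 1 →
      pressureTT'₂ β t t' U u v ≤ pressureTT'₂ β t t' U x₀ y₀ + s₁ * (u - x₀) + s₂ * (v - y₀) := by
  -- the strict hypograph over the open square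
  obtain ⟨F, hF⟩ : ∃ F : ℝ × ℝ × ℝ → ℝ, ∀ q, F q = pressureTT'₂ β t t' U q.1 q.2.1 - q.2.2 := ⟨_, fun q => rfl⟩
  set O : Set (ℝ × ℝ × ℝ) := Set.Ioo (0 : ℝ) 1 ×ˢ (Set.Ioo (0 : ℝ) 1 ×ˢ Set.univ) with hO
  set S : Set (ℝ × ℝ × ℝ) := O ∩ F ⁻¹' Set.Ioi 0 with hS
  have hOopen : IsOpen O := isOpen_Ioo.prod (isOpen_Ioo.prod isOpen_univ)
  -- continuity of `F` on `O`
  have hFcont : ContinuousOn F O := by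
    have hproj : ContinuousOn (fun q : ℝ × ℝ × ℝ => (q.1, q.2.1)) O := by fun_prop
    have hmaps : Set.MapsTo (fun q : ℝ × ℝ × ℝ => (q.1, q.2.1)) O (Set.Ico (0 : ℝ) 1 ×ˢ Set.Ico (0 : ℝ) 1) := by
      rintro ⟨u, v, r⟩ ⟨hu, hv, -⟩
      exact ⟨⟨hu.1.le, hu.2⟩, ⟨hv.1.le, hv.2⟩⟩
    have h1 := ContinuousOn.comp (g := fun z : ℝ × ℝ => pressureTT'₂ β t t' U z.1 z.2)
      (continuousOn_pressureTT'₂ hβ t t' hU) hproj hmaps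
    have h2 : ContinuousOn (fun q : ℝ × ℝ × ℝ => q.2.2) O := by fun_prop
    refine (h1.sub h2).congr (fun q _ => ?_)
    rw [hF q, Pi.sub_apply, Function.comp_apply]
  have hSopen : IsOpen S := hFcont.isOpen_inter_preimage hOopen isOpen_Ioi
  -- convexity of `S`
  have hconc := concaveOn_pressureTT'₂ hβ t t' hU
  have hSconv : Convex ℝ S := by
    rintro ⟨u₁, v₁, r₁⟩ ⟨⟨hu₁, hv₁, -⟩, hr₁⟩ ⟨u₂, v₂, r₂⟩ ⟨⟨hu₂, hv₂, -⟩, hr₂⟩ a b ha hb hab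
    simp only [Set.mem_preimage, Set.mem_Ioi, hF] at hr₁ hr₂
    refine ⟨⟨?_, ?_, Set.mem_univ _⟩, ?_⟩
    · exact (convex_Ioo 0 1) hu₁ hu₂ ha hb hab
    · exact (convex_Ioo 0 1) hv₁ hv₂ ha hb hab
    · simp only [Set.mem_preimage, Set.mem_Ioi, hF, Prod.smul_mk, Prod.mk_add_mk, smul_eq_mul]
      have hc := hconc.2 (x := (u₁, v₁)) ⟨⟨hu₁.1.le, hu₁.2⟩, ⟨hv₁.1.le, hv₁.2⟩⟩ (y := (u₂, v₂))
        ⟨⟨hu₂.1.le, hu₂.2⟩, ⟨hv₂.1.le, hv₂.2⟩⟩ ha hb hab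
      simp only [Prod.smul_mk, Prod.mk_add_mk, smul_eq_mul] at hc
      -- `a r₁ + b r₂ < a p₁ + b p₂ ≤ p(a z₁ + b z₂)` unless `a = 0` or `b = 0` degenerate: handle with cases
      rcases ha.eq_or_lt with rfl | ha'
      · rw [zero_add] at hab; subst hab; simp only [zero_mul, zero_add, one_mul] at hc ⊢; linarith
      · have : a * r₁ < a * pressureTT'₂ β t t' U u₁ v₁ := mul_lt_mul_of_pos_left (by linarith) ha'
        have : b * r₂ ≤ b * pressureTT'₂ β t t' U u₂ v₂ := mul_le_mul_of_nonneg_left (by linarith) hb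
        linarith
  -- the boundary point
  set P : ℝ × ℝ × ℝ := (x₀, y₀, pressureTT'₂ β t t' U x₀ y₀) with hP
  have hPnot : P ∉ S := by
    rintro ⟨-, hr⟩
    simp only [Set.mem_preimage, Set.mem_Ioi, hF, hP] at hr
    linarith
  obtain ⟨φ, hφ⟩ := geometric_hahn_banach_open_point hSconv hSopen hPnot
  -- coordinates of `φ`
  set α : ℝ := φ (1, 0, 0) with hα
  set γ : ℝ := φ (0, 1, 0) with hγ
  set c : ℝ := φ (0, 0, 1) with hc
  have hφapply : ∀ u v r : ℝ, φ (u, v, r) = α * u + γ * v + c * r := by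
    intro u v r
    have e : ((u, v, r) : ℝ × ℝ × ℝ) = u • (1, 0, 0) + v • (0, 1, 0) + r • (0, 0, 1) := by
      ext <;> simp
    rw [e, map_add, map_add, map_smul, map_smul, map_smul, smul_eq_mul, smul_eq_mul, smul_eq_mul]
    ring
  -- `c > 0`: the point one unit below `P` lies in `S`
  have hbelow : (x₀, y₀, pressureTT'₂ β t t' U x₀ y₀ - 1) ∈ S := by
    refine ⟨⟨⟨hx0, hx1⟩, ⟨hy0, hy1⟩, Set.mem_univ _⟩, ?_⟩
    simp only [Set.mem_preimage, Set.mem_Ioi, hF]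
    linarith
  have hcpos : 0 < c := by
    have h := hφ _ hbelow
    rw [hφapply, hP, hφapply] at h
    linarith
  refine ⟨-α / c, -γ / c, fun u v hu0 hu1 hv0 hv1 => ?_⟩
  refine plane_extend hβ t t' hU (fun u v hu0 hu1 hv0 hv1 => ?_) hu0 hu1 hv0 hv1
  -- on the open square: every `r < p(u,v)` gives `αu + γv + cr < αx₀ + γy₀ + c p(x₀,y₀)`
  have key : ∀ ε : ℝ, 0 < ε →
      α * u + γ * v + c * (pressureTT'₂ β t t' U u v - ε) < α * x₀ + γ * y₀ + c * pressureTT'₂ β t t' U x₀ y₀ := by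
    intro ε hε
    have hmemS : (u, v, pressureTT'₂ β t t' U u v - ε) ∈ S := by
      refine ⟨⟨⟨hu0, hu1⟩, ⟨hv0, hv1⟩, Set.mem_univ _⟩, ?_⟩
      simp only [Set.mem_preimage, Set.mem_Ioi, hF]
      linarith
    have h := hφ _ hmemS
    rwa [hφapply, hP, hφapply] at h
  -- let `ε → 0`
  have hle : α * u + γ * v + c * pressureTT'₂ β t t' U u v ≤ α * x₀ + γ * y₀ + c * pressureTT'₂ β t t' U x₀ y₀ := by
    refine le_of_forall_pos_lt_add fun ε hε => ?_
    have h := key (ε / c) (by positivity)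
    have e : c * (pressureTT'₂ β t t' U u v - ε / c) = c * pressureTT'₂ β t t' U u v - ε := by field_simp
    rw [e] at h
    linarith
  -- divide by `c`
  have e : pressureTT'₂ β t t' U x₀ y₀ + -α / c * (u - x₀) + -γ / c * (v - y₀) =
      (α * x₀ + γ * y₀ + c * pressureTT'₂ β t t' U x₀ y₀ - α * u - γ * v) / c := by
    field_simp
    ring
  rw [e, le_div_iff₀ hcpos]
  linarith

end SupportingPlane

end ThermodynamicLimit

end Literature.MathematicalPhysics.QuantumLattice
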